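import Summits.NavierStokesRegularity.NavierStokesRegularity.Theses.DulacContraction
import HarnessLib.Audit

/-!
# Birth skeleton (BC3) of the crux `DulacContraction.SynchronizationForcesSelfSimilarity`

(crux item `stmt-NavierStokesRegularity-8560`, rank 3, route
`route-NavierStokesRegularity-DulacContraction`; tree path
`Cruxes/SynchronizationForcesSelfSimilarity/Lines/birth.lean`; registrar
`planner-skel-stmt-NavierStokesRegularity-8560-0`, 2026-08-17. The route (rev 6) predates the Lean
birth certificate; this file supplies BC3 retroactively. At registration the crux had no workfiles:
no `Disproof.lean`, no earlier lines, no crux ideas — so there is no disprover obligation to honour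
yet; the negatives index (4 entries) contains nothing about recurrent or self-similar profiles.)

THE CRUX (K2 of the route, fixed; the route's decl BY NAME). In the route's notation: profiles at
log-scale `σ`, `Π_σ w (y) = e^σ w(−e^{2σ}, e^σ y)` (`nsRescale (exp σ) w (-1) y`); the weighted slice
energy `E(f) = ∫ ‖f y‖² (1+‖y‖²)⁻² dy` (a lower Lebesgue integral); the similarity action
`(g·w)(t,x) = l Rᵀ w(l² t + τ, l R x + ξ)`, `g = (l, R, ξ, τ)`; and `SyncModSim C` = crux K1
`SynchronizationModSimilarity` at the single rate `C`. K2 says: `SyncModSim C` ⇒ every smooth profile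
`(w,q,H)` of the Albritton–Barker Type-I class `𝒦_C` (suitable weak on the slab `ℝ³ × (−∞,0)`, weak
gradient, `typeIBound < ⊤`, rate `C/√(−t)`, classical on `(−∞,0)`) that is SINGULAR at the origin
and UNIFORMLY RECURRENT under the scaling flow in `L³_loc({t ≤ 0} × ℝ³)` is invariant a.e. on the
slab under ONE similarity with dilation factor `l > 1` (`τ ≤ 0`): it is SS/RSS/DSS/RDSS about some
centre.

TYPING NOTE. The route file abbreviates `Π_σ`, `E`, the action and `SyncModSim` by four `let`s. The
stubs below state the SAME terms with the `let`s expanded by hand (beta/zeta-equal, so the composition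
is by `exact`), under `open Literature.Analysis.FluidPDE MeasureTheory`: a registered stub signature
must not contain `:=` (the registry's signature scanner cuts at the first `:=`), and the expanded,
short-name form keeps every signature under the registry's length cap. A prover restating a stub
opens the same two namespaces.

THE CUT — the route's own foreseen layer 2 ("ApproximateToExactFactor", "TranslationExclusion"),
made precise as a three-step dynamical chain on the compact minimal set `M = cl{w_σ}` of the
scaling flow (zoom-in = `σ ↓ −∞`):

* `stub_asymptoticSelfSimilarity` [XL, OPEN — the load-bearing stub; where K1 is consumed]
  K1 at rate `C` + singular at `0` + uniformly recurrent ⇒ `w` is EXPONENTIALLY ASYMPTOTICALLY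
  SELF-SIMILAR ABOUT ITS SINGULAR POINT under zoom-in: there are a zoom-in similarity centred at the
  space–time origin, `g = (l, R, 0, 0)` with `0 < l < 1`, and `η' > 0`, `c'`, `σ₀` with
  `E(Π_σ w − Π_σ(g·w)) ≤ c' e^{η' σ}` for all `σ ≤ σ₀`. This bundles (a) the asymptotic-phase step
  (K1's `∃ g` carries NO localisation near the comparison element `g₀`, so K1 applied to a pair on
  ONE similarity orbit — e.g. `(w, w_s)` at a recurrence scale `s`, the pair the route's "proof
  intended" uses — is satisfied by the trivial phase; the content must come from pairs of DISTINCT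
  points of `M`, i.e. from minimality, or from re-deriving a localised phase), (b) translation /
  time-shift exclusion (the centre is the singular point: a time shift `τ < 0` puts the centre in
  the smooth interior and forces `Π_σ w → 0`, i.e. regularity at `0` by one-slice ε-regularity; a
  space shift is excluded by recurrence ABOUT `0`), (c) "uniform synchronisation on a compact
  minimal set ⇒ asymptotic relative periodicity". Sources: LiMuldowney1995 (autonomous convergence),
  Smith1986, LianYoung2012, Ma2022 (Pesin theory for semiflows on Hilbert/Banach spaces),
  AlbrittonBarker2019 Lemma 2.2 / Prop. 2.3 (compactness, persistence — PROVED in tree),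
  BarkerPrange2020 / JiaSverak2014 (ε-regularity).
* `stub_exactFactorInOrbitClosure` [L, KNOWN MECHANISM — Cauchy telescoping] for `g = (l,R,0,0)`
  the action is an exact isometry between scales, `E(Π_σ(g·u) − Π_σ(g·v)) = E(Π_{σ+log l} u −
  Π_{σ+log l} v)` (the weight is radial, `R` is measure preserving), so exponential asymptotic
  `g`-invariance makes `(g^k·w)_k` Cauchy at every scale `σ ≤ σ₀`, uniformly; by compactness of
  the class in `L³_loc` (tree: `SuitableCompactness_holds`) and of `O(3)` a subsequence converges
  to a class profile `z` in the ROTATED orbit closure, hence (undoing the limit rotation) to one in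
  the orbit closure of `w`, with `E(Π_σ z − Π_σ(g·z)) = 0` for `σ ≤ σ₀`: `z = g·z` on a final time
  interval, on the whole slab by backward uniqueness (EscauriazaSereginSverak2003) — and then
  `z = g⁻¹·z`, `g⁻¹ = (l⁻¹ > 1, R⁻¹, 0, 0)`. Conclusion typed in the crux's own (weaker) shape:
  some smooth class profile `z` in the `L³_loc` orbit closure of `w` is invariant a.e. under a
  similarity with factor `> 1`, `τ ≤ 0`.
* `stub_recurrentInheritsSelfSimilarity` [M, KNOWN MECHANISM — Birkhoff/Gottschalk–Hedlund] the
  orbit closure of a uniformly recurrent point of the (continuous, by `SuitableCompactness_holds`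
  compact) scaling flow is MINIMAL, so `w` lies in the closure of the FORWARD (zoom-out) semi-orbit
  of any `z ∈ M`; zoom-outs of a `g`-invariant `z`, `g = (l,R,ξ,τ)`, are invariant under
  `(l, R, e^{−σ}ξ, e^{−2σ}τ) → (l, R, 0, 0)` (`σ → +∞`; or an exact conjugate if `σ` stays bounded),
  and invariance passes to `L³_loc` limits (continuity of the action, uniform on the precompact
  orbit). Sources: Birkhoff 1927 Ch. VII, Furstenberg1981 Ch. 1 §4 (tree vocabulary
  `Literature.Dynamics.TopologicalDynamics`; the inlined recurrence clause IS
  `IsScalingUniformlyRecurrent` by `Iff.rfl`), AlbrittonBarker2019 Lemma 2.2.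

`SynchronizationForcesSelfSimilarity_of : SynchronizationForcesSelfSimilarity` is the ONLY theorem of
this file concluding the crux (A12 layer invariant of `ledger skeleton check`: conclusion = the crux
BY NAME, no `Prop` hypotheses, `sorry` only inside the three declared stubs, which it uses by
name); it is the real composition: stub 1 gives `(l, R, η', c', σ₀)`, stub 2 an exactly
self-similar class profile `z` in the orbit closure, stub 3 transfers exact self-similarity to `w`.
Its CLOSED twin with the stub STATEMENTS as hypotheses,
`SynchronizationForcesSelfSimilarity_of_hyps : <sig 1> → <sig 2> → <sig 3> → SynchronizationForcesSelfSimilarity`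
(same proof, no placeholder anywhere), is the registrar's evidence file
`bc/SynchronizationForcesSelfSimilarity_birth_closed.lean`.

BC3 PROBES (registrar folder `bc/probe_*.lean`): for each stub `S`, `S → SynchronizationForcesSelfSimilarity`
and `S → NavierStokesRegularity` by each of `exact?`, `simpa using h`, `aesop`, `unfold; aesop` FAIL
(quoted in `Lines/birth.md`): no stub is cheaply the crux or the summit. Stub 1 concludes an
asymptotic statement only; stub 2 concludes about a limit profile `z`, never about `w`; stub 3 needs
an exactly self-similar `z` in the orbit closure, which the crux does not provide (instantiating
`z := w` is circular).
-/

noncomputable section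

open Set MeasureTheory Filter Topology
open Literature.Analysis.FluidPDE

namespace Summit.NavierStokesRegularity.NavierStokesRegularity.Cruxes.SynchronizationForcesSelfSimilarity.Birth

set_option linter.unusedVariables false
set_option linter.dupNamespace false

/-- **stub 1 — `stub_asymptoticSelfSimilarity` (XL; OPEN — the load-bearing stub, where K1 =
`SyncModSim C` is consumed; its first hypothesis after `C` IS the crux's `SyncModSim C`, expanded).**
Under K1 at rate `C`, a smooth profile `(w,q,H)` of `𝒦_C` that is singular at the origin and
uniformly recurrent under scaling in `L³_loc({t ≤ 0} × ℝ³)` is exponentially asymptotically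
self-similar about the origin under zoom-in: for some zoom-in similarity `g = (l, R, 0, 0)`,
`0 < l < 1`, centred at the space–time origin, and some `η' > 0`, `c'`, `σ₀`:
`E(Π_σ w − Π_σ(g·w)) ≤ c' e^{η' σ}` for every `σ ≤ σ₀`. Contains the asymptotic-phase step (K1's
`∃ g` is not localised near `g₀`, so same-orbit pairs give nothing; LiMuldowney1995, Smith1986,
LianYoung2012, Ma2022) and translation/time-shift exclusion (BarkerPrange2020, JiaSverak2014;
AlbrittonBarker2019 Prop. 2.3). -/
theorem stub_asymptoticSelfSimilarity :
    ∀ C : ℝ,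
      (∃ η c δ : ℝ, 0 < η ∧ 0 ≤ c ∧ 0 < δ ∧
        ∀ (u : ℝ → EuclideanSpace ℝ (Fin 3) → EuclideanSpace ℝ (Fin 3)) (p : ℝ → EuclideanSpace ℝ (Fin 3) → ℝ) (G : ℝ → EuclideanSpace ℝ (Fin 3) → EuclideanSpace ℝ (Fin 3) →L[ℝ] EuclideanSpace ℝ (Fin 3)),
          IsSuitableWeakSolutionOn (slab (EuclideanSpace ℝ (Fin 3)) (Set.Iio 0) isOpen_Iio) 1 0 u p →
          HasWeakSpatialGradientOn (slab (EuclideanSpace ℝ (Fin 3)) (Set.Iio 0) isOpen_Iio) u G →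
          typeIBound (Set.Iio (0 : ℝ) ×ˢ Set.univ) u p G < ⊤ →
          HasTypeITimeDecay C u →
          IsClassicalNSSolutionOn (Set.Iio 0) 1 0 u p →
        ∀ (w : ℝ → EuclideanSpace ℝ (Fin 3) → EuclideanSpace ℝ (Fin 3)) (q : ℝ → EuclideanSpace ℝ (Fin 3) → ℝ) (H : ℝ → EuclideanSpace ℝ (Fin 3) → EuclideanSpace ℝ (Fin 3) →L[ℝ] EuclideanSpace ℝ (Fin 3)),
          IsSuitableWeakSolutionOn (slab (EuclideanSpace ℝ (Fin 3)) (Set.Iio 0) isOpen_Iio) 1 0 w q →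
          HasWeakSpatialGradientOn (slab (EuclideanSpace ℝ (Fin 3)) (Set.Iio 0) isOpen_Iio) w H →
          typeIBound (Set.Iio (0 : ℝ) ×ˢ Set.univ) w q H < ⊤ →
          HasTypeITimeDecay C w →
          IsClassicalNSSolutionOn (Set.Iio 0) 1 0 w q →
        ∀ (σ₀ l₀ : ℝ) (R₀ : EuclideanSpace ℝ (Fin 3) ≃ₗᵢ[ℝ] EuclideanSpace ℝ (Fin 3)) (ξ₀ : EuclideanSpace ℝ (Fin 3)) (τ₀ : ℝ), 0 < l₀ → τ₀ ≤ 0 →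
          ∫⁻ y, ‖nsRescale (Real.exp σ₀) w (-1) y - nsRescale (Real.exp σ₀) (fun t x => l₀ • R₀.symm (u (l₀ ^ 2 * t + τ₀) (l₀ • R₀ x + ξ₀))) (-1) y‖ₑ ^ 2 * ENNReal.ofReal ((1 + ‖y‖ ^ 2)⁻¹ ^ 2) ≤ ENNReal.ofReal δ →
          ∃ (l : ℝ) (R : EuclideanSpace ℝ (Fin 3) ≃ₗᵢ[ℝ] EuclideanSpace ℝ (Fin 3)) (ξ : EuclideanSpace ℝ (Fin 3)) (τ : ℝ), 0 < l ∧ τ ≤ 0 ∧ ∀ σ : ℝ, σ ≤ σ₀ →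
            ∫⁻ y, ‖nsRescale (Real.exp σ) w (-1) y - nsRescale (Real.exp σ) (fun t x => l • R.symm (u (l ^ 2 * t + τ) (l • R x + ξ))) (-1) y‖ₑ ^ 2 * ENNReal.ofReal ((1 + ‖y‖ ^ 2)⁻¹ ^ 2) ≤ ENNReal.ofReal (c * Real.exp (-(η * (σ₀ - σ))) * δ)) →
      ∀ (w : ℝ → EuclideanSpace ℝ (Fin 3) → EuclideanSpace ℝ (Fin 3)) (q : ℝ → EuclideanSpace ℝ (Fin 3) → ℝ) (H : ℝ → EuclideanSpace ℝ (Fin 3) → EuclideanSpace ℝ (Fin 3) →L[ℝ] EuclideanSpace ℝ (Fin 3)),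
        IsSuitableWeakSolutionOn (slab (EuclideanSpace ℝ (Fin 3)) (Set.Iio 0) isOpen_Iio) 1 0 w q →
        HasWeakSpatialGradientOn (slab (EuclideanSpace ℝ (Fin 3)) (Set.Iio 0) isOpen_Iio) w H →
        typeIBound (Set.Iio (0 : ℝ) ×ˢ Set.univ) w q H < ⊤ →
        HasTypeITimeDecay C w →
        IsClassicalNSSolutionOn (Set.Iio 0) 1 0 w q →
        IsBackwardSingularPoint w 0 →
        (∀ ε : ℝ, 0 < ε → ∀ K : Set (ℝ × EuclideanSpace ℝ (Fin 3)), IsCompact K → K ⊆ Set.Iic (0 : ℝ) ×ˢ Set.univ →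
          ∃ L : ℝ, 0 < L ∧ ∀ a : ℝ, ∃ σ ∈ Set.Icc a (a + L),
            eLpNorm (fun z : ℝ × EuclideanSpace ℝ (Fin 3) => nsRescale (Real.exp σ) w z.1 z.2 - w z.1 z.2) 3 (volume.restrict K) ≤ ENNReal.ofReal ε) →
        ∃ (l : ℝ) (R : EuclideanSpace ℝ (Fin 3) ≃ₗᵢ[ℝ] EuclideanSpace ℝ (Fin 3)) (η' c' σ₀ : ℝ), 0 < l ∧ l < 1 ∧ 0 < η' ∧
          ∀ σ : ℝ, σ ≤ σ₀ → ∫⁻ y, ‖nsRescale (Real.exp σ) w (-1) y - nsRescale (Real.exp σ) (fun t x => l • R.symm (w (l ^ 2 * t) (l • R x))) (-1) y‖ₑ ^ 2 * ENNReal.ofReal ((1 + ‖y‖ ^ 2)⁻¹ ^ 2) ≤ ENNReal.ofReal (c' * Real.exp (η' * σ)) := by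
  sorry

/-- **stub 2 — `stub_exactFactorInOrbitClosure` (L; KNOWN MECHANISM: Cauchy telescoping along
`g^k·w` — for `g = (l,R,0,0)` one has `E(Π_σ(g·u) − Π_σ(g·v)) = E(Π_{σ+log l} u − Π_{σ+log l} v)`
exactly — plus compactness of the class in `L³_loc` (tree `SuitableCompactness_holds`,
AlbrittonBarker2019 Lemma 2.2) and of `O(3)`, interior regularity to pass the slice functional to
the limit, and backward uniqueness (EscauriazaSereginSverak2003) to spread `z = g·z` from a final
time interval to the slab; finally `z = g⁻¹·z` with factor `l⁻¹ > 1`).** A smooth profile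
`(w,q,H)` of `𝒦_C` that is exponentially asymptotically self-similar about the origin under
zoom-in (conclusion of stub 1) has, in the `L³_loc({t ≤ 0} × ℝ³)`-closure of its scaling orbit, a
smooth profile `(z,r,J)` of `𝒦_C` (same `C`) invariant a.e. on the slab under a similarity with
dilation factor `> 1` and `τ ≤ 0` (the crux's own shape of self-similarity). -/
theorem stub_exactFactorInOrbitClosure :
    ∀ (C : ℝ) (w : ℝ → EuclideanSpace ℝ (Fin 3) → EuclideanSpace ℝ (Fin 3)) (q : ℝ → EuclideanSpace ℝ (Fin 3) → ℝ) (H : ℝ → EuclideanSpace ℝ (Fin 3) → EuclideanSpace ℝ (Fin 3) →L[ℝ] EuclideanSpace ℝ (Fin 3)),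
      IsSuitableWeakSolutionOn (slab (EuclideanSpace ℝ (Fin 3)) (Set.Iio 0) isOpen_Iio) 1 0 w q →
      HasWeakSpatialGradientOn (slab (EuclideanSpace ℝ (Fin 3)) (Set.Iio 0) isOpen_Iio) w H →
      typeIBound (Set.Iio (0 : ℝ) ×ˢ Set.univ) w q H < ⊤ →
      HasTypeITimeDecay C w →
      IsClassicalNSSolutionOn (Set.Iio 0) 1 0 w q →
      (∃ (l : ℝ) (R : EuclideanSpace ℝ (Fin 3) ≃ₗᵢ[ℝ] EuclideanSpace ℝ (Fin 3)) (η' c' σ₀ : ℝ), 0 < l ∧ l < 1 ∧ 0 < η' ∧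
        ∀ σ : ℝ, σ ≤ σ₀ → ∫⁻ y, ‖nsRescale (Real.exp σ) w (-1) y - nsRescale (Real.exp σ) (fun t x => l • R.symm (w (l ^ 2 * t) (l • R x))) (-1) y‖ₑ ^ 2 * ENNReal.ofReal ((1 + ‖y‖ ^ 2)⁻¹ ^ 2) ≤ ENNReal.ofReal (c' * Real.exp (η' * σ))) →
      ∃ (z : ℝ → EuclideanSpace ℝ (Fin 3) → EuclideanSpace ℝ (Fin 3)) (r : ℝ → EuclideanSpace ℝ (Fin 3) → ℝ) (J : ℝ → EuclideanSpace ℝ (Fin 3) → EuclideanSpace ℝ (Fin 3) →L[ℝ] EuclideanSpace ℝ (Fin 3)),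
        IsSuitableWeakSolutionOn (slab (EuclideanSpace ℝ (Fin 3)) (Set.Iio 0) isOpen_Iio) 1 0 z r ∧
        HasWeakSpatialGradientOn (slab (EuclideanSpace ℝ (Fin 3)) (Set.Iio 0) isOpen_Iio) z J ∧
        typeIBound (Set.Iio (0 : ℝ) ×ˢ Set.univ) z r J < ⊤ ∧
        HasTypeITimeDecay C z ∧
        IsClassicalNSSolutionOn (Set.Iio 0) 1 0 z r ∧
        (∀ ε : ℝ, 0 < ε → ∀ K : Set (ℝ × EuclideanSpace ℝ (Fin 3)), IsCompact K → K ⊆ Set.Iic (0 : ℝ) ×ˢ Set.univ →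
          ∃ σ : ℝ, eLpNorm (fun v : ℝ × EuclideanSpace ℝ (Fin 3) => nsRescale (Real.exp σ) w v.1 v.2 - z v.1 v.2) 3 (volume.restrict K) ≤ ENNReal.ofReal ε) ∧
        (∃ l : ℝ, 1 < l ∧ ∃ (R : EuclideanSpace ℝ (Fin 3) ≃ₗᵢ[ℝ] EuclideanSpace ℝ (Fin 3)) (ξ : EuclideanSpace ℝ (Fin 3)) (τ : ℝ), τ ≤ 0 ∧
          (fun v : ℝ × EuclideanSpace ℝ (Fin 3) => l • R.symm (z (l ^ 2 * v.1 + τ) (l • R v.2 + ξ))) =ᵐ[volume.restrict (Set.Iio (0 : ℝ) ×ˢ Set.univ)] (fun v : ℝ × EuclideanSpace ℝ (Fin 3) => z v.1 v.2)) := by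
  sorry

/-- **stub 3 — `stub_recurrentInheritsSelfSimilarity` (M; KNOWN MECHANISM: the orbit closure of a
uniformly recurrent point of the scaling flow — continuous on the class, compact in `L³_loc` by
`SuitableCompactness_holds` — is MINIMAL (Birkhoff 1927 Ch. VII; Gottschalk–Hedlund; Furstenberg1981
Ch. 1 §4; tree `Literature.Dynamics.TopologicalDynamics`, and `IsScalingUniformlyRecurrent` is the
inlined clause by `Iff.rfl`), so `w` is an `L³_loc` limit of ZOOM-OUTS `z_{σ_n}`, `σ_n → +∞` or
bounded, of any `z` in it; a `(l,R,ξ,τ)`-invariant `z` has `z_σ` invariant under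
`(l, R, e^{−σ}ξ, e^{−2σ}τ)`, which converges in the similarity group, and a.e.-invariance passes
to `L³_loc` limits by continuity of the action, uniform on the precompact orbit).** If a smooth
profile `(w,q,H)` of `𝒦_C` is uniformly recurrent under scaling in `L³_loc({t ≤ 0} × ℝ³)` and some
smooth profile `(z,r,J)` of `𝒦_C` in the `L³_loc`-closure of its scaling orbit is invariant a.e.
on the slab under a similarity with factor `> 1`, `τ ≤ 0`, then so is `w` (possibly under another
such similarity). -/
theorem stub_recurrentInheritsSelfSimilarity :
    ∀ (C : ℝ) (w : ℝ → EuclideanSpace ℝ (Fin 3) → EuclideanSpace ℝ (Fin 3)) (q : ℝ → EuclideanSpace ℝ (Fin 3) → ℝ) (H : ℝ → EuclideanSpace ℝ (Fin 3) → EuclideanSpace ℝ (Fin 3) →L[ℝ] EuclideanSpace ℝ (Fin 3)),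
      IsSuitableWeakSolutionOn (slab (EuclideanSpace ℝ (Fin 3)) (Set.Iio 0) isOpen_Iio) 1 0 w q →
      HasWeakSpatialGradientOn (slab (EuclideanSpace ℝ (Fin 3)) (Set.Iio 0) isOpen_Iio) w H →
      typeIBound (Set.Iio (0 : ℝ) ×ˢ Set.univ) w q H < ⊤ →
      HasTypeITimeDecay C w →
      IsClassicalNSSolutionOn (Set.Iio 0) 1 0 w q →
      (∀ ε : ℝ, 0 < ε → ∀ K : Set (ℝ × EuclideanSpace ℝ (Fin 3)), IsCompact K → K ⊆ Set.Iic (0 : ℝ) ×ˢ Set.univ →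
        ∃ L : ℝ, 0 < L ∧ ∀ a : ℝ, ∃ σ ∈ Set.Icc a (a + L),
          eLpNorm (fun z : ℝ × EuclideanSpace ℝ (Fin 3) => nsRescale (Real.exp σ) w z.1 z.2 - w z.1 z.2) 3 (volume.restrict K) ≤ ENNReal.ofReal ε) →
      ∀ (z : ℝ → EuclideanSpace ℝ (Fin 3) → EuclideanSpace ℝ (Fin 3)) (r : ℝ → EuclideanSpace ℝ (Fin 3) → ℝ) (J : ℝ → EuclideanSpace ℝ (Fin 3) → EuclideanSpace ℝ (Fin 3) →L[ℝ] EuclideanSpace ℝ (Fin 3)),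
        IsSuitableWeakSolutionOn (slab (EuclideanSpace ℝ (Fin 3)) (Set.Iio 0) isOpen_Iio) 1 0 z r →
        HasWeakSpatialGradientOn (slab (EuclideanSpace ℝ (Fin 3)) (Set.Iio 0) isOpen_Iio) z J →
        typeIBound (Set.Iio (0 : ℝ) ×ˢ Set.univ) z r J < ⊤ →
        HasTypeITimeDecay C z →
        IsClassicalNSSolutionOn (Set.Iio 0) 1 0 z r →
        (∀ ε : ℝ, 0 < ε → ∀ K : Set (ℝ × EuclideanSpace ℝ (Fin 3)), IsCompact K → K ⊆ Set.Iic (0 : ℝ) ×ˢ Set.univ →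
          ∃ σ : ℝ, eLpNorm (fun v : ℝ × EuclideanSpace ℝ (Fin 3) => nsRescale (Real.exp σ) w v.1 v.2 - z v.1 v.2) 3 (volume.restrict K) ≤ ENNReal.ofReal ε) →
        (∃ l : ℝ, 1 < l ∧ ∃ (R : EuclideanSpace ℝ (Fin 3) ≃ₗᵢ[ℝ] EuclideanSpace ℝ (Fin 3)) (ξ : EuclideanSpace ℝ (Fin 3)) (τ : ℝ), τ ≤ 0 ∧
          (fun v : ℝ × EuclideanSpace ℝ (Fin 3) => l • R.symm (z (l ^ 2 * v.1 + τ) (l • R v.2 + ξ))) =ᵐ[volume.restrict (Set.Iio (0 : ℝ) ×ˢ Set.univ)] (fun v : ℝ × EuclideanSpace ℝ (Fin 3) => z v.1 v.2)) →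
        ∃ l : ℝ, 1 < l ∧ ∃ (R : EuclideanSpace ℝ (Fin 3) ≃ₗᵢ[ℝ] EuclideanSpace ℝ (Fin 3)) (ξ : EuclideanSpace ℝ (Fin 3)) (τ : ℝ), τ ≤ 0 ∧
          (fun v : ℝ × EuclideanSpace ℝ (Fin 3) => l • R.symm (w (l ^ 2 * v.1 + τ) (l • R v.2 + ξ))) =ᵐ[volume.restrict (Set.Iio (0 : ℝ) ×ˢ Set.univ)] (fun v : ℝ × EuclideanSpace ℝ (Fin 3) => w v.1 v.2) := by
  sorry

/-- **Birth composition (the skeleton theorem).** The crux BY NAME from the three registered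
stubs, used by name: introduce the crux's hypotheses (its four `let`s are zeta-reduced in place by
the `whnf` behind `intro`; the stubs state the same terms expanded, so everything matches
definitionally); stub 1 (fed with K1 at rate `C`, singularity and recurrence) gives the exponential
asymptotic self-similarity about the origin; stub 2 turns it into an exactly self-similar class
profile `z` in the orbit closure; stub 3 (fed with the recurrence of `w`) transfers exact
self-similarity back to `w`. Pure logic. -/
theorem SynchronizationForcesSelfSimilarity_of :
    Theses.DulacContraction.SynchronizationForcesSelfSimilarity := by
  -- `intro` exposes the binders by `whnf`, which zeta-reduces the crux's four `let`s in place
  intro C hK1 w q H hsw hgr hIb hdec hcl hsing hrec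
  -- stub 1: exponential asymptotic self-similarity of `w` about its singular point
  obtain ⟨l, R, η', c', σ₀, hl₀, hl₁, hη', hasym⟩ :=
    stub_asymptoticSelfSimilarity C hK1 w q H hsw hgr hIb hdec hcl hsing hrec
  -- stub 2: an exactly self-similar class profile `z` in the orbit closure of `w`
  obtain ⟨z, r, J, hzsw, hzgr, hzIb, hzdec, hzcl, hzorb, hzinv⟩ :=
    stub_exactFactorInOrbitClosure C w q H hsw hgr hIb hdec hcl ⟨l, R, η', c', σ₀, hl₀, hl₁, hη', hasym⟩
  -- stub 3: minimality of the orbit closure transfers exact self-similarity to `w`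
  exact stub_recurrentInheritsSelfSimilarity C w q H hsw hgr hIb hdec hcl hrec z r J hzsw hzgr hzIb hzdec
    hzcl hzorb hzinv

end Summit.NavierStokesRegularity.NavierStokesRegularity.Cruxes.SynchronizationForcesSelfSimilarity.Birth
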